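import Mathlib
import Summits.ResolutionOfSingularities.ResolutionOfSingularities.Theses.SyzygyFlattening
import Summits.ResolutionOfSingularities.ResolutionOfSingularities.Theorems.SyzygyFlatteningDefs
import Summits.ResolutionOfSingularities.ResolutionOfSingularities.Theorems.SyzygyFlatteningHigherRankTerminationTowerStageBasic
import Summits.ResolutionOfSingularities.ResolutionOfSingularities.Theorems.SyzygyFlatteningHigherRankTerminationTowerLocalisation
import Summits.ResolutionOfSingularities.ResolutionOfSingularities.Theorems.SyzygyFlatteningRankOneTerminationStageNormal
import Summits.ResolutionOfSingularities.ResolutionOfSingularities.Theorems.SyzygyFlatteningRankOneTerminationStageDim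
import Summits.ResolutionOfSingularities.ResolutionOfSingularities.Theorems.SyzygyFlatteningRankOneTerminationReduction
import Summits.ResolutionOfSingularities.ResolutionOfSingularities.Theorems.SyzygyFlatteningRankOneTerminationSurfaceStep
import HarnessLib

/-!
# The surface case of `RankOneTermination`, from Lipman's theorem (valuative form)
# (crux stmt-ResolutionOfSingularities-17044, line `birth`)

Crux `RankOneTermination` (route `SyzygyFlattening`): valuative termination of the
syzygy-flattening tower.  By `stub_surfaceStep` (landed: `…SurfaceStep.lean`), for `tr.deg_k K = 2`
the tower from `T₁` on IS the sequence of normalised quadratic transforms along the valuation —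
the local rings, at the centres of `v`, of Lipman's sequence "blow up the singular points,
normalise" (Lipman, Ann. Math. 107 (1978), Theorem p. 151; Liu 2002, Thm. 8.3.44; in tree as the
scheme-level named fact `Literature.….Lipman1978SequenceFinite`; its valuative corollary is filed as
the Literature fact `Lipman1978ValuativeQuadraticSequence`, proposal p162714, whose statement is
VERBATIM the hypothesis `hL` below at universe `0`).  This file proves, kernel-checked:

* `stub_surfaceCase` (registered glue stub of the line) — the valuative Lipman statement implies
  termination of the tower along EVERY valuation ring `O ⊇ A` when `tr.deg_k K = 2` (no rank or
  dimension hypothesis): the stages `R i := T_{i+1}` with the elements `x i` of `stub_surfaceStep`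
  satisfy the recursion of the fact (`T₁` normal, essentially of finite type, local at the centre;
  `locAt`, `nrm` are definitionally the spelled-out `Algebra.adjoin`s);
* `rankOneTermination_of_syzygyIndex_eq_two` — hence the `n = 2` slice of `RankOneTermination`.
-/

noncomputable section

-- single-problem summit: the doubled namespace component `ResolutionOfSingularities` is forced
set_option linter.dupNamespace false

namespace Summit.ResolutionOfSingularities.ResolutionOfSingularities.Theorems.SyzygyFlattening

open IsLocalRing

variable {k K : Type} [Field k] [Field K] [Algebra k K]

/-- **STUB `stub_surfaceCase` (crux stmt-ResolutionOfSingularities-17044, line `birth`) — the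
surface case of the crux from Lipman's theorem in valuative form.**  Hypothesis: the valuative
corollary of Lipman 1978 (verbatim the body of the Literature fact
`Lipman1978ValuativeQuadraticSequence` at universe `0`).  Conclusion: for `tr.deg_k K = 2` the
syzygy-flattening tower terminates along every valuation ring `O ⊇ A` of `K = Frac A`.
Proof: `R i := tower O A (i+1)`, `x i :=` the element of `stub_surfaceStep` at singular stages;
the hypotheses of the fact are `essFiniteType_tower`, `isFractionRing_tower`, `tower_toSubring_le`,
`locAt_tower`, `stub_stageNormal`, and the recursion is `stub_surfaceStep` (up to unfolding
`locAt`, `nrm`); `Algebra.trdeg k K = 2` is `syzygyIndex_eq_trdeg`.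
[cite: Lipman1978, Theorem p. 151; Liu2002, Thm. 8.3.44] -/
theorem stub_surfaceCase :
    (∀ (k K : Type) [Field k] [Field K] [Algebra k K] (O : ValuationSubring K)
        (R : ℕ → Subalgebra k K) (x : ℕ → K),
        (∀ c : k, algebraMap k K c ∈ O) → Algebra.trdeg k K = 2 →
        Algebra.EssFiniteType k ↥(R 0) → IsFractionRing ↥(R 0) K → (R 0).toSubring ≤ O.toSubring →
        Algebra.adjoin k {y : K | ∃ a ∈ R 0, ∃ s ∈ R 0, s⁻¹ ∈ O ∧ y = a * s⁻¹} = R 0 →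
        IsIntegrallyClosed ↥(R 0) →
        (∀ i : ℕ, ¬ IsRegularLocalRing ↥(R i) →
          x i ∈ R i ∧ O.valuation (x i) < 1 ∧
            (∀ y ∈ R i, O.valuation y < 1 → O.valuation y ≤ O.valuation (x i)) ∧
            R (i + 1) =
              Algebra.adjoin k {y : K | ∃ a ∈ Algebra.adjoin k {z : K | IsIntegral
                  ↥(Algebra.adjoin k ((R i : Set K) ∪
                    {w : K | ∃ a ∈ R i, O.valuation a < 1 ∧ w = a * (x i)⁻¹})) z},
                ∃ s ∈ Algebra.adjoin k {z : K | IsIntegral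
                  ↥(Algebra.adjoin k ((R i : Set K) ∪
                    {w : K | ∃ a ∈ R i, O.valuation a < 1 ∧ w = a * (x i)⁻¹})) z},
                s⁻¹ ∈ O ∧ y = a * s⁻¹}) →
        ∃ i : ℕ, IsRegularLocalRing ↥(R i)) →
    ∀ (k K : Type) [Field k] [Field K] [Algebra k K] (O : ValuationSubring K) (A : Subalgebra k K),
      (∀ c : k, algebraMap k K c ∈ O) → A.FG → IsFractionRing ↥A K → A.toSubring ≤ O.toSubring →
      syzygyIndex k K = 2 → TowerTerminates O A := by
  intro hL k K _ _ _ O A hk hFG hFrac hAO hn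
  classical
  let R : ℕ → Subalgebra k K := fun i => tower O A (i + 1)
  let x : ℕ → K := fun i =>
    if h : IsRegularLocalRing ↥(tower O A (i + 1)) then 0
    else Classical.choose (stub_surfaceStep k K O A hk hFG hFrac hAO hn i h)
  have hstep : ∀ i : ℕ, ¬ IsRegularLocalRing ↥(R i) →
      x i ∈ R i ∧ O.valuation (x i) < 1 ∧
        (∀ y ∈ R i, O.valuation y < 1 → O.valuation y ≤ O.valuation (x i)) ∧
        R (i + 1) = locAt O (nrm (Algebra.adjoin k ((R i : Set K) ∪
          {y : K | ∃ a ∈ R i, O.valuation a < 1 ∧ y = a * (x i)⁻¹}))) := by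
    intro i hsing
    have hsing' : ¬ IsRegularLocalRing ↥(tower O A (i + 1)) := hsing
    have hx : x i = Classical.choose (stub_surfaceStep k K O A hk hFG hFrac hAO hn i hsing') := by
      show (if h : IsRegularLocalRing ↥(tower O A (i + 1)) then (0 : K)
        else Classical.choose (stub_surfaceStep k K O A hk hFG hFrac hAO hn i h)) = _
      rw [dif_neg hsing']
    rw [hx]
    exact Classical.choose_spec (stub_surfaceStep k K O A hk hFG hFrac hAO hn i hsing')
  have htr : Algebra.trdeg k K = 2 := by
    have h := syzygyIndex_eq_trdeg A hFG hFrac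
    rw [hn] at h
    exact_mod_cast h.symm
  obtain ⟨i, hi⟩ := hL k K O R x hk htr
    (essFiniteType_tower O A hk hFG hFrac hAO 1) (isFractionRing_tower O A hFrac 1)
    (tower_toSubring_le O hk hAO 1) (locAt_tower O A hk hAO 1)
    (stub_stageNormal k K O A hk hFG hFrac hAO 0) hstep
  exact ⟨i + 1, hi⟩

/-- **The `n = 2` slice of `RankOneTermination` from Lipman's theorem (valuative form)**: for every
prime `p`, field `k` of characteristic `p`, `K/k` of transcendence degree `2` and rank-one
dimension-zero valuation ring `O ⊇ A ⊇ k`, the tower terminates (rank and dimension hypotheses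
unused). [cite: Lipman1978, Theorem p. 151] -/
theorem rankOneTermination_of_syzygyIndex_eq_two
    (hL : (∀ (k K : Type) [Field k] [Field K] [Algebra k K] (O : ValuationSubring K)
        (R : ℕ → Subalgebra k K) (x : ℕ → K),
        (∀ c : k, algebraMap k K c ∈ O) → Algebra.trdeg k K = 2 →
        Algebra.EssFiniteType k ↥(R 0) → IsFractionRing ↥(R 0) K → (R 0).toSubring ≤ O.toSubring →
        Algebra.adjoin k {y : K | ∃ a ∈ R 0, ∃ s ∈ R 0, s⁻¹ ∈ O ∧ y = a * s⁻¹} = R 0 →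
        IsIntegrallyClosed ↥(R 0) →
        (∀ i : ℕ, ¬ IsRegularLocalRing ↥(R i) →
          x i ∈ R i ∧ O.valuation (x i) < 1 ∧
            (∀ y ∈ R i, O.valuation y < 1 → O.valuation y ≤ O.valuation (x i)) ∧
            R (i + 1) =
              Algebra.adjoin k {y : K | ∃ a ∈ Algebra.adjoin k {z : K | IsIntegral
                  ↥(Algebra.adjoin k ((R i : Set K) ∪
                    {w : K | ∃ a ∈ R i, O.valuation a < 1 ∧ w = a * (x i)⁻¹})) z},
                ∃ s ∈ Algebra.adjoin k {z : K | IsIntegral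
                  ↥(Algebra.adjoin k ((R i : Set K) ∪
                    {w : K | ∃ a ∈ R i, O.valuation a < 1 ∧ w = a * (x i)⁻¹})) z},
                s⁻¹ ∈ O ∧ y = a * s⁻¹}) →
        ∃ i : ℕ, IsRegularLocalRing ↥(R i))) :
    ∀ (p : ℕ), p.Prime → ∀ (k K : Type) [Field k] [CharP k p] [Field K] [Algebra k K]
      (O : ValuationSubring K) (A : Subalgebra k K), (∀ c : k, algebraMap k K c ∈ O) → A.FG →
      IsFractionRing ↥A K → A.toSubring ≤ O.toSubring → DimZero k O → ringKrullDim ↥O = 1 →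
      syzygyIndex k K = 2 → TowerTerminates O A :=
  fun _ _ k K _ _ _ _ O A hk hFG hFrac hAO _ _ hn =>
    stub_surfaceCase hL k K O A hk hFG hFrac hAO hn

end Summit.ResolutionOfSingularities.ResolutionOfSingularities.Theorems.SyzygyFlattening

end
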